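import Summits.CriticalPhenomena.Ising3DConformalLimit.Theorems.SubPtolemyInterlacingInterlacingBalancedSuffices
import Summits.CriticalPhenomena.Ising3DConformalLimit.Theorems.SubPtolemyInterlacingInterlacingBoxSwitching
import Summits.CriticalPhenomena.Ising3DConformalLimit.Theorems.SubPtolemyInterlacingInterlacingBoxLimit
import HarnessLib

/-!
# Line `Sketch`, BALANCED variant — prepared skeleton for the RESTATED crux (lead c1, cycle 1; not registrable until the
# planner restates stmt-CriticalPhenomena-15702)

If the planner restates the crux `Interlacing` to the balanced family (candidate B of `Lines/Sketch_restate.lean`,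
`∀ N ≥ 1, SPC(2N, N, 3N)`, or the eventual dyadic candidate A), the line `Sketch` survives verbatim with ONE open stub:

* `stub_engineBalanced` — the box merging threshold at the balanced shapes only: for every `N ≥ 1`, eventually in `L`,
  `P₂ᴸ(P₁ᴸ+P₂ᴸ+P₃ᴸ) − P₁ᴸP₃ᴸ ≤ 2(P₂ᴸ)²·𝐏^{x₁x₃,x₂x₄}_{Λ_L}[x₁ ↔ x₂]` at `(a,b,c) = (2N, N, 3N)` (hypothesis-free: at `z = ½`
  the Lebowitz corner is empty, `(u−1)(t−1) ≈ 1.1–1.35 < 2` at every scale, so no regime split is needed);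
* composition `interlacingBalanced_of`: the landed `stub_boxSwitching` (ADC21 (3.11) in `Λ_L`) turns it into box SPC and the
  landed `stub_boxLimit` passes to `Λ_L ↑ ℤ³`; `interlacingBalancedDyadic_of` and `ising3D_of_stub_engineBalanced` chain it to
  the landed transfer (`transfer_ising3D_of_balanced`), i.e. to the sub-problem given `SubPtolemyFloor` and `MoebiusLimit`.

`lean check`: rc 0, exactly one `sorry` (the stub). Numbers (kit j020588/j020648, N = 1): `I× = 0.87–0.96` against
`ι* = 0.30–0.33`; continuum (bootstrap) `0.755` against `0.448`.
-/

noncomputable section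

namespace Summit.CriticalPhenomena.Ising3DConformalLimit.Cruxes.Interlacing.SketchBalanced

open Filter MeasureTheory
open scoped symmDiff Topology
open Literature.Probability.LatticeModels Literature.Probability.Percolation
open Summit.CriticalPhenomena.Ising3DConformalLimit.Theses.SubPtolemyInterlacing
open Summit.CriticalPhenomena.Ising3DConformalLimit.Cruxes.Interlacing.Sketch

/-- **Stub (balanced engine): the interlaced meeting threshold in boxes at the balanced shapes `(2N, N, 3N)`.**
For every `N ≥ 1`, eventually in `L`, with `x₁ = 0`, `x₂ = 2N e₁`, `x₃ = 3N e₁`, `x₄ = 6N e₁` in the free box `Λ_L` at `β_c`: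
`P₂ᴸ(P₁ᴸ+P₂ᴸ+P₃ᴸ) − P₁ᴸP₃ᴸ ≤ 2(P₂ᴸ)²·𝐏^{{x₁}∆{x₃},{x₂}∆{x₄}}_{Λ_L}[x₁ ↔ x₂]`, i.e. `𝐏[merge] ≥ ι*_L(2N,N,3N)`. -/
theorem stub_engineBalanced : ∀ N : ℕ, 1 ≤ N →
    ∀ᶠ L : ℕ in atTop,
      isingTwoPoint (zdGraph 3) (box 3 L) (criticalBeta 3) 0 .free (Pi.single 0 ((0 : ℕ) : ℤ)) (Pi.single 0 ((2 * N + N : ℕ) : ℤ)) *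
            isingTwoPoint (zdGraph 3) (box 3 L) (criticalBeta 3) 0 .free (Pi.single 0 ((2 * N : ℕ) : ℤ)) (Pi.single 0 ((2 * N + N + 3 * N : ℕ) : ℤ)) *
          (isingTwoPoint (zdGraph 3) (box 3 L) (criticalBeta 3) 0 .free (Pi.single 0 ((0 : ℕ) : ℤ)) (Pi.single 0 ((2 * N : ℕ) : ℤ)) *
            isingTwoPoint (zdGraph 3) (box 3 L) (criticalBeta 3) 0 .free (Pi.single 0 ((2 * N + N : ℕ) : ℤ)) (Pi.single 0 ((2 * N + N + 3 * N : ℕ) : ℤ)) +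
            isingTwoPoint (zdGraph 3) (box 3 L) (criticalBeta 3) 0 .free (Pi.single 0 ((0 : ℕ) : ℤ)) (Pi.single 0 ((2 * N + N : ℕ) : ℤ)) *
            isingTwoPoint (zdGraph 3) (box 3 L) (criticalBeta 3) 0 .free (Pi.single 0 ((2 * N : ℕ) : ℤ)) (Pi.single 0 ((2 * N + N + 3 * N : ℕ) : ℤ)) +
            isingTwoPoint (zdGraph 3) (box 3 L) (criticalBeta 3) 0 .free (Pi.single 0 ((0 : ℕ) : ℤ)) (Pi.single 0 ((2 * N + N + 3 * N : ℕ) : ℤ)) *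
            isingTwoPoint (zdGraph 3) (box 3 L) (criticalBeta 3) 0 .free (Pi.single 0 ((2 * N : ℕ) : ℤ)) (Pi.single 0 ((2 * N + N : ℕ) : ℤ))) -
        isingTwoPoint (zdGraph 3) (box 3 L) (criticalBeta 3) 0 .free (Pi.single 0 ((0 : ℕ) : ℤ)) (Pi.single 0 ((2 * N : ℕ) : ℤ)) *
            isingTwoPoint (zdGraph 3) (box 3 L) (criticalBeta 3) 0 .free (Pi.single 0 ((2 * N + N : ℕ) : ℤ)) (Pi.single 0 ((2 * N + N + 3 * N : ℕ) : ℤ)) *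
          (isingTwoPoint (zdGraph 3) (box 3 L) (criticalBeta 3) 0 .free (Pi.single 0 ((0 : ℕ) : ℤ)) (Pi.single 0 ((2 * N + N + 3 * N : ℕ) : ℤ)) *
            isingTwoPoint (zdGraph 3) (box 3 L) (criticalBeta 3) 0 .free (Pi.single 0 ((2 * N : ℕ) : ℤ)) (Pi.single 0 ((2 * N + N : ℕ) : ℤ))) ≤
      2 * (isingTwoPoint (zdGraph 3) (box 3 L) (criticalBeta 3) 0 .free (Pi.single 0 ((0 : ℕ) : ℤ)) (Pi.single 0 ((2 * N + N : ℕ) : ℤ)) *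
            isingTwoPoint (zdGraph 3) (box 3 L) (criticalBeta 3) 0 .free (Pi.single 0 ((2 * N : ℕ) : ℤ)) (Pi.single 0 ((2 * N + N + 3 * N : ℕ) : ℤ))) ^ 2 *
          (sourcedDoubleCurrentLaw 3 L (criticalBeta 3) ({(Pi.single 0 ((0 : ℕ) : ℤ))} ∆ {(Pi.single 0 ((2 * N + N : ℕ) : ℤ))})
            ({(Pi.single 0 ((2 * N : ℕ) : ℤ))} ∆ {(Pi.single 0 ((2 * N + N + 3 * N : ℕ) : ℤ))})).real
            (openConn (Pi.single 0 ((0 : ℕ) : ℤ)) (Pi.single 0 ((2 * N : ℕ) : ℤ))) := by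
  sorry

/-- **Composition for candidate B**: the balanced engine gives SPC at every balanced quadruple `(0, 2N, 3N, 6N)·e₁`, `N ≥ 1`
(landed `stub_boxSwitching` + `stub_boxLimit` at `(a,b,c) = (2N, N, 3N)`, then the axis-site spelling
`(m:ℤ)•e₁ = Pi.single 0 m`). -/
theorem interlacingBalanced_of : ∀ N : ℕ, 1 ≤ N →
    criticalCorr 3 4 ![Pi.single 0 ((0 : ℕ) : ℤ), Pi.single 0 ((2 * N : ℕ) : ℤ),
        Pi.single 0 ((3 * N : ℕ) : ℤ), Pi.single 0 ((6 * N : ℕ) : ℤ)] *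
        (criticalCorr 3 2 ![Pi.single 0 ((0 : ℕ) : ℤ), Pi.single 0 ((3 * N : ℕ) : ℤ)] *
          criticalCorr 3 2 ![Pi.single 0 ((2 * N : ℕ) : ℤ), Pi.single 0 ((6 * N : ℕ) : ℤ)]) ≤
      criticalCorr 3 2 ![Pi.single 0 ((0 : ℕ) : ℤ), Pi.single 0 ((2 * N : ℕ) : ℤ)] *
          criticalCorr 3 2 ![Pi.single 0 ((3 * N : ℕ) : ℤ), Pi.single 0 ((6 * N : ℕ) : ℤ)] *
        (criticalCorr 3 2 ![Pi.single 0 ((0 : ℕ) : ℤ), Pi.single 0 ((6 * N : ℕ) : ℤ)] *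
          criticalCorr 3 2 ![Pi.single 0 ((2 * N : ℕ) : ℤ), Pi.single 0 ((3 * N : ℕ) : ℤ)]) := by
  intro N hN
  have hev := stub_engineBalanced N hN
  have hbox := stub_boxLimit (2 * N) N (3 * N) (by
    filter_upwards [hev, eventually_ge_atTop (2 * N + N + 3 * N)] with L hL hLabc
    rw [stub_boxSwitching L (2 * N) N (3 * N) hLabc]
    nlinarith [hL])
  have e3 : 2 * N + N = 3 * N := by ring
  have e6 : 2 * N + N + 3 * N = 6 * N := by ring
  simp only [Summit.CriticalPhenomena.Ising3DConformalLimit.Theorems.interlacingForcesU4_axSite_eq] at hbox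
  rw [e6, e3] at hbox
  exact hbox

/-- **Composition for candidate A** (eventual balanced dyadic form, `K = 0`). -/
theorem interlacingBalancedDyadic_of :
    ∃ K : ℕ, ∀ k : ℕ, K ≤ k →
      criticalCorr 3 4 ![Pi.single 0 ((0 : ℕ) : ℤ), Pi.single 0 ((2 * 2 ^ (k + 1) : ℕ) : ℤ),
          Pi.single 0 ((3 * 2 ^ (k + 1) : ℕ) : ℤ), Pi.single 0 ((6 * 2 ^ (k + 1) : ℕ) : ℤ)] *
          (criticalCorr 3 2 ![Pi.single 0 ((0 : ℕ) : ℤ), Pi.single 0 ((3 * 2 ^ (k + 1) : ℕ) : ℤ)] *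
            criticalCorr 3 2 ![Pi.single 0 ((2 * 2 ^ (k + 1) : ℕ) : ℤ),
              Pi.single 0 ((6 * 2 ^ (k + 1) : ℕ) : ℤ)]) ≤
        criticalCorr 3 2 ![Pi.single 0 ((0 : ℕ) : ℤ), Pi.single 0 ((2 * 2 ^ (k + 1) : ℕ) : ℤ)] *
            criticalCorr 3 2 ![Pi.single 0 ((3 * 2 ^ (k + 1) : ℕ) : ℤ),
              Pi.single 0 ((6 * 2 ^ (k + 1) : ℕ) : ℤ)] *
          (criticalCorr 3 2 ![Pi.single 0 ((0 : ℕ) : ℤ), Pi.single 0 ((6 * 2 ^ (k + 1) : ℕ) : ℤ)] *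
            criticalCorr 3 2 ![Pi.single 0 ((2 * 2 ^ (k + 1) : ℕ) : ℤ),
              Pi.single 0 ((3 * 2 ^ (k + 1) : ℕ) : ℤ)]) :=
  transfer_eventualBalanced_of_balanced 0 fun N _ hN => interlacingBalanced_of N hN

/-- **The restated line closes the sub-problem modulo `stub_engineBalanced`, `SubPtolemyFloor`, `MoebiusLimit`.** -/
theorem ising3D_of_stub_engineBalanced (hF : SubPtolemyFloor) (hML : MoebiusLimit) : _root_.Ising3DConformalLimit :=
  transfer_ising3D_of_eventualBalanced interlacingBalancedDyadic_of hF hML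

end Summit.CriticalPhenomena.Ising3DConformalLimit.Cruxes.Interlacing.SketchBalanced

end
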